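import Literature.Analysis.FunctionSpaces.HolderChartRestriction
import Literature.Analysis.FunctionSpaces.ContDiffHolderMollify
import HarnessLib

/-!
# Smooth approximation in `C^{0,r}_𝔄(M, F)` with bounded Hölder norms (Hölder spaces, part 21)

Topic `Literature/Analysis/FunctionSpaces`. On a compact manifold `M` with Hölder chart data `𝔄`
(part 4), every `f ∈ C^{0,r}_𝔄(M, F)` (`0 < r ≤ 1`... only `r ≤ 1` is used) is a UNIFORM limit of
smooth functions `g_ε ∈ C^{0,r}_𝔄(M, F)` whose `C^{0,r}_𝔄`-norms are bounded by `C‖f‖` with `C`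
depending only on `𝔄`: mollify each chart piece (part 20), cut off and extend by zero (part 11),
and sum:

* `HolderChartData.contMDiff_extendByZero` — the extension by zero of a smooth function compactly
  supported in a chart target is smooth on `M`;
* `HolderManifoldFunction.coe_finset_sum` — pointwise sums;
* `HolderManifoldFunction.exists_smooth_approx` — the approximation theorem:
  `∃ δ > 0, ∃ C, ∀ f, ∀ ε ∈ (0, δ], ∃ g` smooth with `‖g‖ ≤ C‖f‖` and `‖g x − f x‖ ≤ C‖f‖ε^r`.

This is the approximation step of the surjectivity argument for elliptic operators between the
manifold Hölder spaces (census item (2c) of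
`Literature.Geometry.Riemannian.gurskyViaclovsky_pathOpen_weighted_four`: `C^{0,α}` data are
uniform limits of smooth data with bounded Hölder norms, so that smooth solvability plus the
Schauder estimate plus Arzelà–Ascoli (parts 17–18) give `C^{2,α}` solvability). Everything is
proved; no named facts.

## References

* D. Gilbarg, N. S. Trudinger, *Elliptic Partial Differential Equations of Second Order* (2001),
  §6.2, §7.2. [GilbargTrudinger2001]
-/

noncomputable section

open Set Filter Metric Function
open scoped NNReal Topology Manifold ContDiff

namespace Literature.Analysis.FunctionSpaces

/-! ### Smoothness of extensions by zero -/

namespace HolderChartData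

variable {ι : Type*} {E : Type*} [NormedAddCommGroup E] [NormedSpace ℝ E]
  {M : Type*} [TopologicalSpace M] [ChartedSpace E M] [T2Space M] (𝔄 : HolderChartData ι E M)
  {F : Type*} [NormedAddCommGroup F] [NormedSpace ℝ F]

/-- **The extension by zero of a smooth function compactly supported in a chart target is smooth
on `M`.** On the chart source it is `v ∘ chart_i`; off the compact set
`chart_i⁻¹(tsupport v)` it vanishes identically. [folklore] -/
theorem contMDiff_extendByZero {n : WithTop ℕ∞} [IsManifold 𝓘(ℝ, E) n M] (i : ι) {v : E → F}
    (hv : ContDiff ℝ n v) (hvs : HasCompactSupport v) (hvt : tsupport v ⊆ (𝔄.chart i).target) :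
    ContMDiff 𝓘(ℝ, E) 𝓘(ℝ, F) n (𝔄.extendByZero i v) := by
  -- the compact set outside of which the extension vanishes
  set C : Set M := (𝔄.chart i).symm '' tsupport v with hC
  have hCc : IsCompact C := hvs.image_of_continuousOn ((𝔄.chart i).continuousOn_symm.mono hvt)
  have hCsrc : C ⊆ (𝔄.chart i).source := by
    rintro _ ⟨y, hy, rfl⟩
    exact (𝔄.chart i).map_target (hvt hy)
  have hzero : ∀ z, z ∉ C → 𝔄.extendByZero i v z = 0 := by
    intro z hz
    by_cases hzs : z ∈ (𝔄.chart i).source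
    · rw [𝔄.extendByZero_apply_of_mem i v hzs]
      refine image_eq_zero_of_notMem_tsupport fun hmem => hz ?_
      exact ⟨𝔄.chart i z, hmem, (𝔄.chart i).left_inv hzs⟩
    · exact 𝔄.extendByZero_apply_of_not_mem i v hzs
  intro x
  by_cases hx : x ∈ (𝔄.chart i).source
  · -- near `x`: `v ∘ chart_i`
    have h1 : ContMDiffOn 𝓘(ℝ, E) 𝓘(ℝ, F) n (v ∘ 𝔄.chart i) (𝔄.chart i).source :=
      hv.contMDiff.comp_contMDiffOn contMDiffOn_chart
    refine (h1.contMDiffAt ((𝔄.chart i).open_source.mem_nhds hx)).congr_of_eventuallyEq ?_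
    filter_upwards [(𝔄.chart i).open_source.mem_nhds hx] with z hz
    exact 𝔄.extendByZero_apply_of_mem i v hz
  · -- away from `C`: identically zero
    have hxC : x ∉ C := fun h => hx (hCsrc h)
    refine (contMDiffAt_const (c := (0 : F))).congr_of_eventuallyEq ?_
    filter_upwards [hCc.isClosed.isOpen_compl.mem_nhds hxC] with z hz
    exact hzero z hz

end HolderChartData

/-! ### The approximation theorem -/

section Approx

variable {ι : Type*} [Fintype ι] {E : Type} [NormedAddCommGroup E] [NormedSpace ℝ E]
  [FiniteDimensional ℝ E] {M : Type*} [TopologicalSpace M] [ChartedSpace E M]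
  [IsManifold 𝓘(ℝ, E) ∞ M] [CompactSpace M] [T2Space M] (𝔄 : HolderChartData ι E M)
  {F : Type} [NormedAddCommGroup F] [NormedSpace ℝ F] {k : ℕ} {r : ℝ≥0}

omit [Fintype ι] [FiniteDimensional ℝ E] [IsManifold 𝓘(ℝ, E) ∞ M] [CompactSpace M] [T2Space M] in
/-- Pointwise finite sums in `C^{k,r}_𝔄(M, F)`. [folklore] -/
theorem HolderManifoldFunction.coe_finset_sum {α : Type*} (s : Finset α)
    (u : α → HolderManifoldFunction 𝔄 F k r) (x : M) :
    (∑ a ∈ s, u a) x = ∑ a ∈ s, u a x := by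
  classical
  induction s using Finset.induction_on with
  | empty => simp
  | insert a s ha ih => simp [Finset.sum_insert ha, ih]

/-- **Smooth approximation in `C^{0,r}_𝔄(M, F)` with bounded norms.** There are `δ > 0` and
`C` (depending only on the chart data) such that every `f ∈ C^{0,r}_𝔄(M, F)` and every
`ε ∈ (0, δ]` admit a smooth `g ∈ C^{0,r}_𝔄(M, F)` with `‖g‖ ≤ C‖f‖` and
`‖g(x) − f(x)‖ ≤ C‖f‖ε^r` for all `x` (mollify the chart pieces at scale `ε`, cut off, extend by
zero and sum). [cite: GilbargTrudinger2001, §6.2, §7.2] -/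
theorem HolderManifoldFunction.exists_smooth_approx [CompleteSpace F] (hr : r ≤ 1) :
    ∃ δ : ℝ, 0 < δ ∧ ∃ C : ℝ, ∀ (f : HolderManifoldFunction 𝔄 F 0 r) (ε : ℝ), 0 < ε → ε ≤ δ →
      ∃ g : HolderManifoldFunction 𝔄 F 0 r, ContMDiff 𝓘(ℝ, E) 𝓘(ℝ, F) ∞ (g : M → F) ∧
        ‖g‖ ≤ C * ‖f‖ ∧ ∀ x, ‖g x - f x‖ ≤ C * ‖f‖ * ε ^ (r : ℝ) := by
  classical
  -- the compact sets `K_i = chart_i(tsupport ρ_i)` and their admissible thickenings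
  have hK := fun i => 𝔄.isCompact_image_tsupport i
  choose δi hδi hδiU using fun i =>
    (hK i).1.exists_cthickening_subset_open (𝔄.chart i).open_target (hK i).2
  set K' : ι → Set E := fun i => cthickening (δi i) (𝔄.chart i '' tsupport (𝔄.ρ i)) with hK'
  have hK'c : ∀ i, IsCompact (K' i) := fun i => (hK i).1.cthickening
  -- cutoffs `η_i = 1` near `K'_i`, supported in the chart targets
  choose η hη hηs hηt hη1 _hη01 using fun i =>
    exists_contDiff_one_nhdsSet_of_isCompact (hK'c i) (𝔄.chart i).open_target (hδiU i)
  -- the extension operators and the constants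
  set T : ι → (ContDiffHolderFunction E F 0 r →L[ℝ] HolderManifoldFunction 𝔄 F 0 r) :=
    fun i => chartExtendCLM 𝔄 hr i (η i) (hη i) (hηs i) (hηt i) with hT
  set δ : ℝ := 1 / (1 + ∑ i, (δi i)⁻¹) with hδ
  have hS : 0 ≤ ∑ i, (δi i)⁻¹ := Finset.sum_nonneg fun i _ => (inv_pos.2 (hδi i)).le
  have hδpos : 0 < δ := by rw [hδ]; positivity
  have hδle : ∀ i, δ ≤ δi i := by
    intro i
    rw [hδ, div_le_iff₀ (by positivity)]
    have h1 : (δi i)⁻¹ ≤ ∑ j, (δi j)⁻¹ :=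
      Finset.single_le_sum (fun j _ => (inv_pos.2 (hδi j)).le) (Finset.mem_univ i)
    have h2 : 1 = δi i * (δi i)⁻¹ := (mul_inv_cancel₀ (hδi i).ne').symm
    nlinarith [hδi i]
  set C : ℝ := 2 * ∑ i, ‖T i‖ + Fintype.card ι with hCdef
  have hC1 : 2 * ∑ i, ‖T i‖ ≤ C := by
    rw [hCdef]; exact le_add_of_nonneg_right (Nat.cast_nonneg _)
  have hC2 : (Fintype.card ι : ℝ) ≤ C := by
    rw [hCdef]
    exact le_add_of_nonneg_left (mul_nonneg zero_le_two (Finset.sum_nonneg fun i _ => norm_nonneg _))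
  refine ⟨δ, hδpos, C, fun f ε hε hεδ => ?_⟩
  -- mollify the pieces
  choose g hgs hgn hgd hgsupp using fun i => (f.toPieces i).exists_contDiff_approx hε
  have hgK' : ∀ i, tsupport (g i : E → F) ⊆ K' i := fun i =>
    (hgsupp i).trans (((cthickening_mono (hεδ.trans (hδle i)) _).trans'
      (cthickening_subset_of_subset _ (𝔄.tsupport_piece_subset (f : M → F) i))))
  -- `η_i • g_i = g_i`
  have hηg : ∀ i y, η i y • g i y = g i y := by
    intro i y
    by_cases hy : y ∈ K' i
    · rw [(hη1 i).self_of_nhdsSet y hy, one_smul]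
    · rw [image_eq_zero_of_notMem_tsupport fun h => hy (hgK' i h), smul_zero]
  refine ⟨∑ i, T i (g i), ?_, ?_, fun x => ?_⟩
  · -- smoothness
    have hcoe : ((∑ i, T i (g i) : HolderManifoldFunction 𝔄 F 0 r) : M → F) =
        fun x => ∑ i, 𝔄.extendByZero i (fun y => η i y • g i y) x := by
      funext x
      rw [HolderManifoldFunction.coe_finset_sum]
      rfl
    rw [hcoe]
    refine contMDiff_finsetSum fun i _ => ?_
    exact 𝔄.contMDiff_extendByZero i ((hη i).smul (hgs i)) (hηs i).smul_right
      ((tsupport_smul_subset_left _ _).trans (hηt i))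
  · -- norm bound
    calc ‖∑ i, T i (g i)‖ ≤ ∑ i, ‖T i (g i)‖ := norm_sum_le _ _
      _ ≤ ∑ i, ‖T i‖ * (2 * ‖f‖) := Finset.sum_le_sum fun i _ =>
          ((T i).le_opNorm _).trans (mul_le_mul_of_nonneg_left
            ((hgn i).trans (mul_le_mul_of_nonneg_left (f.norm_toPieces_le i) zero_le_two))
            (norm_nonneg _))
      _ = (2 * ∑ i, ‖T i‖) * ‖f‖ := by rw [← Finset.sum_mul]; ring
      _ ≤ C * ‖f‖ := mul_le_mul_of_nonneg_right hC1 (norm_nonneg _)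
  · -- uniform approximation
    have hfx := 𝔄.apply_eq_sum_indicator_piece (f : M → F) x
    have hterm : ∀ i, ‖𝔄.extendByZero i (fun y => η i y • g i y) x -
        (𝔄.chart i).source.indicator (fun x => 𝔄.piece (f : M → F) i (𝔄.chart i x)) x‖ ≤
        ‖f‖ * ε ^ (r : ℝ) := by
      intro i
      by_cases hx : x ∈ (𝔄.chart i).source
      · rw [𝔄.extendByZero_apply_of_mem i _ hx, indicator_of_mem hx, hηg]
        refine (hgd i (𝔄.chart i x)).trans (mul_le_mul_of_nonneg_right (f.norm_toPieces_le i) ?_)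
        positivity
      · rw [𝔄.extendByZero_apply_of_not_mem i _ hx, indicator_of_notMem hx, sub_zero, norm_zero]
        positivity
    calc ‖(∑ i, T i (g i)) x - f x‖
        = ‖∑ i, (𝔄.extendByZero i (fun y => η i y • g i y) x -
            (𝔄.chart i).source.indicator (fun x => 𝔄.piece (f : M → F) i (𝔄.chart i x)) x)‖ := by
          rw [Finset.sum_sub_distrib, ← hfx, HolderManifoldFunction.coe_finset_sum]
          rfl
      _ ≤ ∑ i, ‖f‖ * ε ^ (r : ℝ) := (norm_sum_le _ _).trans (Finset.sum_le_sum fun i _ => hterm i)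
      _ = Fintype.card ι * (‖f‖ * ε ^ (r : ℝ)) := by
          rw [Finset.sum_const, nsmul_eq_mul, Finset.card_univ]
      _ ≤ C * ‖f‖ * ε ^ (r : ℝ) := by
          rw [mul_assoc]
          exact mul_le_mul_of_nonneg_right hC2 (by positivity)

end Approx

end Literature.Analysis.FunctionSpaces

end
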